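import Literature.NumberTheory.LFunctions.EulerProductPowerSumPositivity
import Literature.NumberTheory.EllipticCurves.NewformSymmSquareJ0Hecke
import Literature.NumberTheory.LFunctions.ZetaLogDerivDisc
import Literature.NumberTheory.LFunctions.RankinEisensteinFactorisation
import HarnessLib

/-!
# The auxiliary Dirichlet series `ζ(s) L(s, Sym² f_i) L(s, Sym² f_j) L(s, Sym² f_i × Sym² f_j)` of a
# pair of elliptic newforms has non-negative coefficients: Hoffstein–Lockhart's `hcoeff₃`, proved,
# and Murty's bound reduced to the CONTINUATION of explicit Euler products

Topic `NumberTheory/EllipticCurves`; namespace `Literature.NumberTheory.EllipticCurves.ModularForms`.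
Definitions with bodies (`symmSqT`, `symmSqRoot`, `symmSqS`, `symmSqA`, `symmSqAFun`, `symmSqSFun`,
`pairZFun`, `pairZ`, `pairPFun`, `pairP`, `zetaFun`) and theorems; no named fact (D-0026). Filed in
support of the named fact `murty_petersson_newform_lower_bound` (`NewformPeterssonSize`). After
`NewformSymmSquareJ0Hecke` that fact follows from Hoffstein–Lockhart's `GL₃ × GL₃` pair data for the
non-CM, non-twist-equivalent pairs `(f_i, f_j)` of elliptic newforms
(`murty_petersson_newform_lower_bound_of_pairData_nonCM'`: a pair function `P_{ij}` holomorphic and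
polynomially bounded on `|s − 2| < 3/2`, with `|P_{ij}(1)| ≪ (N_iN_j)^δ`, and such that
`riemannZeta₁ · L_i · L_j · P_{ij} = (s − 1) ∑ a(n) n^{−s}` with `a ≥ 0`, `a(1) = 1` — the item `hcoeff₃`).
This file makes `P_{ij}` EXPLICIT and PROVES `hcoeff₃` for it:

* `symmSqA f p = (1, S_f(p))`, `S_f(p) = (1, u_p, ū_p)` at `p ∤ N` (`u_p = exp(i arccos(T_p/2))`,
  `T_p = |a_p|²/p − 2 ∈ [−2, 2]` by Hasse, so `u + ū = T`, `uū = 1`: the normalised Satake parameters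
  `α², αβ, β²` of `Sym² f`), `S_f(p) = (−1, |a_p|²/p, 0)` at `p ∣ N` (the local factor of the
  imprimitive `symmSqL`);
* `IsNewformOf.rankinCoeff_eq` — **`rankinCoeff f = eulerFun A_f`**: the coefficients of
  `ζ(s) L_f(s) = ζ(2s) ∑ |a_n|² n^{−1−s}` (`riemannZeta₁_mul_symmSqL_eq_LSeries`, tree) are those of
  `∏_p ∏_{l<4} (1 − A_f(p)_l p^{−s})⁻¹` (both multiplicative; at a good prime the formal identity
  `(∑_e |a_{p^e}|² p^{−e} X^e)(1 − X)(1 − T X + X²) = 1 + X` from the Hecke recursion,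
  `IsNewform0.localSeries_normSqCoeffDiv_mul`, Bump §3.9);
* `pairZ i j = eulerFun (A_i ⊗ A_j)` — the coefficients `a_{ij} ≥ 0` (`pairZ_nonneg`:
  Goldfeld–Hoffstein–Lieman positivity `EulerProductPowerSumPositivity.eulerFun_nonneg`, the power sums
  of `A_i ⊗ A_j` being `p_k(A_i) p_k(A_j)` with `p_k(A_f(p)) = 2 + 2 Re u_p^k ≥ 0` resp.
  `1 + (−1)^k + (|a_p|²/p)^k ≥ 0`), `a_{ij}(1) = 1`;
* `pairP i j s = L(s, eulerFun (S_i ⊗ S_j))` — **the explicit pair function**: at `p ∤ N_iN_j` the local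
  factor of the Rankin–Selberg convolution `L(s, Sym² f_i × Sym² f_j)`;
* `pair_coeff₃` — **`riemannZeta₁(s) · (L_i(s) L_j(s) P_{ij}(s)) = (s − 1) ∑ a_{ij}(n) n^{−s}`** for
  `Re s > 1`, with `a_{ij} ≥ 0`, `a_{ij}(1) = 1`, absolutely convergent: Hoffstein–Lockhart's `hcoeff₃`,
  for EVERY pair (from the identity of arithmetic functions
  `eulerFun A_i * eulerFun A_j * eulerFun (S_i ⊗ S_j) = eulerFun 1 * eulerFun (A_i ⊗ A_j)`,
  `eulerFun_pair_identity`, checked prime by prime on local generating series);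
* `murty_petersson_newform_lower_bound_of_pairContinuation` (and `_cmJ`) — **the named fact holds as
  soon as, for the non-CM non-twist-equivalent pairs, `P_{ij}` agrees on `Re s > 1` with a function
  holomorphic on `|s − 2| < 3/2`, bounded by `B₂(N_iN_j)^{κ₂}` there and by `T(η)(N_iN_j)^η` at `s = 1`.**

So the residual content of `murty_petersson_newform_lower_bound` is now exactly the analytic
continuation with polynomial bounds, in the level aspect, of the explicit Euler products
`L(s, Sym² f_i × Sym² f_j)` (cuspidality of the Gelbart–Jacquet lifts of non-CM forms,
Mœglin–Waldspurger / Jacquet–Piatetski-Shapiro–Shalika holomorphy for non-isomorphic pairs, and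
convexity bounds with conductor control) — the tree's named facts `GelbartJacquet_symmSq_cuspidal` and
`MoeglinWaldspurger1989_partialPairL_entire_of_ne_conj` (`NumberTheory/Automorphic`) are the first two,
once newforms are matched with cuspidal automorphic representations and their Satake families.

## References

* J. Hoffstein, P. Lockhart, *Coefficients of Maass forms and the Siegel zero* (appendix by
  D. Goldfeld, J. Hoffstein, D. Lieman), Ann. of Math. 140 (1994), 161–181, Thm. 0.1, §1 and Lemma 1.2.
  [cite: HoffsteinLockhart1994, Thm. 0.1, Lemma 1.2]
* D. Goldfeld, *Automorphic Forms and L-Functions for the Group GL(n, ℝ)* (2006), Lemma 8.7.5 and its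
  proof. [cite: Goldfeld2006, Lemma 8.7.5 (proof)]
* D. Bump, *Automorphic Forms and Representations* (1997), §3.9 (the symmetric square local factor).
  [cite: Bump1997, §3.9 (PDF p. 382)]
* M. R. Murty, *Bounds for congruence primes*, Proc. Sympos. Pure Math. 66.1 (1999), §2 (3).
  [cite: MurtyCongruencePrimes1999, §2 (3)]

## Mathlib / tree search

Tree: `EulerProductPowerSumPositivity` (`eulerFun`, `chiFun`, `localSeries`, `localSeries_mul`,
`eulerFun_prime_pow`, `eulerFun_nonneg'`, `LSeriesSummable_eulerFun`, `hasProd_eulerFun`, `psum`,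
`tensorFin`, `psum_tensorFin`, `norm_tensorFin_le`); `SymmPoly.geom/hGen/hsymm`, `geom_mul_one_sub`,
`coeff_geom` (`RingTheory/SymmetricFunctions/SchurPolynomials`); `sqInd`, `normSqCoeffDiv`, `rankinCoeff`,
`riemannZeta₁_mul_symmSqL_eq_LSeries`, `riemannZeta₁_ne_zero_of_one_le_re'` (`RankinSymmSquareGL2Fields`);
`riemannZeta₁_eq_mul` (`ZetaLogDerivDisc`); `IsNewform0.cuspCoeff_prime_pow_add_two`,
`IsNewform0.coeff_mul_of_coprime_holds` (`ModularityVersionAp`); `IsNewform0.norm_cuspCoeff_sq`,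
`IsNewform0.re_cuspCoeff_prime_pow_add_two`, `IsNewform0.cuspCoeff_prime_pow_of_dvd`,
`IsNewform0.norm_cuspCoeff_sq_of_dvd` (`NewformPeterssonSizeSymmSquareProofs`);
`IsNewformOf.norm_cuspCoeff_prime_pow_sq_le`, `EllipticNewformIndex`, `TwistEquiv`
(`RankinSymmSquareTwistComparison`, `NewformPeterssonSizeSiegelReductionProofs`);
`murty_petersson_newform_lower_bound_of_pairData_nonCM'/_cmJ'` (`NewformSymmSquareJ0Hecke`).
`RankinEisenstein.isSquare_prime_pow_iff`, `RankinEisenstein.isSquare_mul_iff_of_coprime`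
(`RankinEisensteinFactorisation`). Mathlib: `ArithmeticFunction.IsMultiplicative.eq_iff_eq_on_prime_powers`, `PowerSeries.coeff_mul_X_pow'`, `riemannZeta_eulerProduct_hasProd`,
`HasProd.unique`, `Complex.norm_exp_ofReal_mul_I`, `Complex.exp_ofReal_mul_I_re`, `Real.cos_arccos`,
`Fin.prod_univ_succ`, `finProdFinEquiv`, `Fintype.prod_equiv`.
-/

noncomputable section

open scoped Real ComplexOrder ComplexConjugate LSeries.notation
open Finset PowerSeries Complex CongruenceSubgroup LSeries
open Literature.RingTheory.SymmetricFunctions.SymmPoly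
open Literature.NumberTheory.LFunctions Literature.NumberTheory.LFunctions.EulerParam

namespace Literature.NumberTheory.EllipticCurves.ModularForms

/-! ### Formal power series helpers -/

/-- `geom 0 = 1`. [folklore] -/
theorem geom_zero_eq_one : geom (0 : ℂ) = 1 := by
  ext k
  rw [coeff_geom, coeff_one]
  rcases k with _ | k <;> simp

/-- `geom c * (1 − cX) = 1` with the scalar written as `C c`-free product `1 - c • X`:
we use the tree's `geom_mul_one_sub`. Two power series with the same right inverse factor agree:
cancellation in the domain `ℂ⟦X⟧`. [folklore] -/
theorem eq_of_mul_eq_mul_of_ne_zero {A B Q : ℂ⟦X⟧} (hQ : Q ≠ 0) (h : A * Q = B * Q) : A = B :=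
  mul_right_cancel₀ hQ h

/-- `1 − cX ≠ 0` in `ℂ⟦X⟧`. [folklore] -/
theorem one_sub_C_mul_X_ne_zero (c : ℂ) : (1 - PowerSeries.C c * X : ℂ⟦X⟧) ≠ 0 := by
  intro h
  have := congrArg (coeff 0) h
  simp at this

/-! ### The local parameters of `ζ · L_f` -/

section Params

variable {N : ℕ} [NeZero N]

/-- `T_p(f) = |a_p|²/p − 2` (`= α_p² + β_p²` for the normalised Satake parameters at a good prime).
[folklore] -/
def symmSqT (f : CuspForm (Gamma0 N) 2) (p : ℕ) : ℝ := ‖cuspCoeff f p‖ ^ 2 / p - 2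

/-- `u_p(f) = exp(i · arccos(T_p/2))`: a unimodular number with `u + ū = T_p` whenever `|T_p| ≤ 2`
(Hasse), i.e. `u = α_p²` up to the choice of the root. [folklore] -/
def symmSqRoot (f : CuspForm (Gamma0 N) 2) (p : ℕ) : ℂ :=
  Complex.exp ((Real.arccos (symmSqT f p / 2) : ℝ) * Complex.I)

omit [NeZero N] in
/-- `|u_p| = 1`. [folklore] -/
theorem norm_symmSqRoot (f : CuspForm (Gamma0 N) 2) (p : ℕ) : ‖symmSqRoot f p‖ = 1 :=
  Complex.norm_exp_ofReal_mul_I _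

omit [NeZero N] in
/-- `u_p ū_p = 1`. [folklore] -/
theorem symmSqRoot_mul_conj (f : CuspForm (Gamma0 N) 2) (p : ℕ) :
    symmSqRoot f p * conj (symmSqRoot f p) = 1 := by
  rw [Complex.mul_conj, Complex.normSq_eq_norm_sq, norm_symmSqRoot]
  simp

omit [NeZero N] in
/-- `u_p + ū_p = T_p` when `|T_p| ≤ 2`. [folklore] -/
theorem symmSqRoot_add_conj (f : CuspForm (Gamma0 N) 2) (p : ℕ) (hT : |symmSqT f p| ≤ 2) :
    symmSqRoot f p + conj (symmSqRoot f p) = (symmSqT f p : ℂ) := by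
  rw [Complex.add_conj, symmSqRoot, Complex.exp_ofReal_mul_I_re, Real.cos_arccos]
  · push_cast; ring
  · have := (abs_le.mp hT).1; linarith
  · have := (abs_le.mp hT).2; linarith

/-- **The three parameters `S_f(p)` of the (naive) symmetric square local factor**: at `p ∤ N`,
`(1, u_p, ū_p)` (`L_p(Sym² f, X)⁻¹ = (1 − X)(1 − u_pX)(1 − ū_pX)`); at `p ∣ N`,
`(−1, |a_p|²/p, 0)` (`L_p = (1 + X)⁻¹(1 − (|a_p|²/p)X)⁻¹`, the local factor of the imprimitive
`symmSqL`). [folklore] -/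
def symmSqS (f : CuspForm (Gamma0 N) 2) (p : ℕ) : Fin 3 → ℂ :=
  if p ∣ N then ![-1, ((‖cuspCoeff f p‖ ^ 2 / p : ℝ) : ℂ), 0]
  else ![1, symmSqRoot f p, conj (symmSqRoot f p)]

/-- **The four parameters `A_f(p) = (1, S_f(p))` of `ζ · L_f`** at `p`. [folklore] -/
def symmSqA (f : CuspForm (Gamma0 N) 2) (p : ℕ) : Fin 4 → ℂ := Fin.cons 1 (symmSqS f p)

/-- The parameters in the closed unit disc (`|a_p|² ≤ 1` at `p ∣ N` for a newform). [folklore] -/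
theorem IsNewform0.norm_symmSqS_le {f : CuspForm (Gamma0 N) 2} (hf : IsNewform0 f) {p : ℕ} (hp : p.Prime)
    (l : Fin 3) : ‖symmSqS f p l‖ ≤ 1 := by
  unfold symmSqS
  split_ifs with hpN
  · have ha : ‖cuspCoeff f p‖ ^ 2 ≤ 1 := by
      rw [hf.norm_cuspCoeff_sq_of_dvd hp hpN]; split_ifs <;> norm_num
    have hp1 : (1 : ℝ) ≤ p := by exact_mod_cast hp.one_lt.le
    fin_cases l
    · simp
    · simp only [Fin.mk_one, Matrix.cons_val_one, Matrix.cons_val_zero, Complex.norm_real, Real.norm_eq_abs]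
      rw [abs_of_nonneg (by positivity), div_le_one (by linarith)]
      linarith
    · simp
  · fin_cases l
    · simp
    · simp [norm_symmSqRoot]
    · simp only [Fin.reduceFinMk, Matrix.cons_val]
      rw [Complex.norm_conj, norm_symmSqRoot]

/-- Hence `|A_f(p)_l| ≤ 1`. [folklore] -/
theorem IsNewform0.norm_symmSqA_le {f : CuspForm (Gamma0 N) 2} (hf : IsNewform0 f) {p : ℕ} (hp : p.Prime)
    (l : Fin 4) : ‖symmSqA f p l‖ ≤ 1 := by
  unfold symmSqA
  refine Fin.cases ?_ (fun i ↦ ?_) l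
  · simp
  · rw [Fin.cons_succ]; exact hf.norm_symmSqS_le hp i

omit [NeZero N] in
/-- **The power sums of `A_f(p)` are non-negative reals**: at `p ∤ N`,
`p_k = 2 + u^k + ū^k = 2 + 2 Re(u^k) ≥ 0` (`|u| = 1`); at `p ∣ N`, `p_k = 1 + (−1)^k + c^k + 0^k ≥ 0`
(`c = |a_p|²/p ≥ 0`). This is where Goldfeld's "either non-negative real numbers or on the unit
circle" enters. [cite: Goldfeld2006, Lemma 8.7.5 (proof)] -/
theorem psum_symmSqA_nonneg (f : CuspForm (Gamma0 N) 2) (p : ℕ) {k : ℕ} (hk : 1 ≤ k) :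
    0 ≤ psum (symmSqA f p) k := by
  unfold psum symmSqA symmSqS
  rw [Fin.sum_univ_four]
  simp only [Fin.cons_zero, one_pow, show (1 : Fin 4) = Fin.succ 0 from rfl, show (2 : Fin 4) = Fin.succ 1 from rfl,
    show (3 : Fin 4) = Fin.succ 2 from rfl, Fin.cons_succ]
  split_ifs with hpN
  · simp only [Matrix.cons_val_zero, Matrix.cons_val_one, Matrix.cons_val]
    rw [zero_pow (by omega), add_zero]
    set c : ℝ := ‖cuspCoeff f p‖ ^ 2 / p with hc
    have hc0 : 0 ≤ c := by positivity
    have hreal : (1 : ℂ) + (-1) ^ k + (c : ℂ) ^ k = (((1 : ℝ) + (-1) ^ k + c ^ k : ℝ) : ℂ) := by push_cast; ring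
    rw [hreal]
    refine Complex.zero_le_real.mpr ?_
    have h1 : (-1 : ℝ) ≤ (-1) ^ k := by
      rcases Nat.even_or_odd k with he | ho
      · rw [he.neg_one_pow]; norm_num
      · rw [ho.neg_one_pow]
    have h2 : 0 ≤ c ^ k := pow_nonneg hc0 k
    linarith
  · simp only [Matrix.cons_val_zero, Matrix.cons_val_one, Matrix.cons_val]
    set u := symmSqRoot f p with hu
    have hconj : (conj u) ^ k = conj (u ^ k) := (map_pow _ _ _).symm
    rw [hconj, one_pow, add_assoc, Complex.add_conj]
    have hre : -1 ≤ (u ^ k).re := by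
      have h1 : |(u ^ k).re| ≤ ‖u ^ k‖ := Complex.abs_re_le_norm _
      rw [norm_pow, norm_symmSqRoot, one_pow] at h1
      exact (abs_le.mp h1).1
    have hreal : (1 : ℂ) + 1 + ((2 * (u ^ k).re : ℝ) : ℂ) = (((2 + 2 * (u ^ k).re : ℝ)) : ℂ) := by push_cast; ring
    rw [hreal]
    exact Complex.zero_le_real.mpr (by linarith)

end Params

/-! ### The local generating series of `rankinCoeff f` -/

section Local

variable {N : ℕ} [NeZero N]

/-- The local series of the square indicator is `∑_k [k even] X^k`. [folklore] -/
theorem localSeries_sqInd_eq_mk {p : ℕ} (hp : p.Prime) :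
    localSeries (toArithmeticFunction sqInd) p = PowerSeries.mk fun k ↦ if Even k then (1 : ℂ) else 0 := by
  ext k
  simp only [localSeries, coeff_mk, toArithmeticFunction, ArithmeticFunction.coe_mk,
    pow_ne_zero _ hp.ne_zero, if_false, sqInd, RankinEisenstein.isSquare_prime_pow_iff hp]

/-- `(∑_k [k even] X^k) · (1 − X²) = 1`. [folklore] -/
theorem evenSeries_mul : (PowerSeries.mk fun k ↦ if Even k then (1 : ℂ) else 0) * (1 - X ^ 2) = 1 := by
  ext n
  rw [mul_sub, mul_one, map_sub, coeff_mul_X_pow', coeff_one, coeff_mk]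
  match n with
  | 0 => simp
  | 1 => simp
  | n + 2 =>
    have hiff : Even (n + 2) ↔ Even n := by simp [Nat.even_add]
    rw [if_pos (show 2 ≤ n + 2 by omega), coeff_mk, Nat.add_sub_cancel, if_neg (show n + 2 ≠ 0 by omega)]
    by_cases he : Even n
    · rw [if_pos (hiff.mpr he), if_pos he, sub_self]
    · rw [if_neg (fun h ↦ he (hiff.mp h)), if_neg he, sub_self]

/-- `geom 1 · geom (−1) · (1 − X²) = 1`. [folklore] -/
theorem geom_one_mul_geom_neg_one_mul : geom (1 : ℂ) * geom (-1) * (1 - X ^ 2) = 1 := by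
  have hpoly : (1 - X ^ 2 : ℂ⟦X⟧) = (1 - PowerSeries.C (1 : ℂ) * X) * (1 - PowerSeries.C (-1 : ℂ) * X) := by
    rw [map_one, map_neg, map_one]; ring
  calc geom (1 : ℂ) * geom (-1) * (1 - X ^ 2)
      = (geom (1 : ℂ) * (1 - PowerSeries.C (1 : ℂ) * X)) * (geom (-1) * (1 - PowerSeries.C (-1 : ℂ) * X)) := by
        rw [hpoly]; ring
    _ = 1 := by rw [geom_mul_one_sub, geom_mul_one_sub, one_mul]

/-- `1 − X² ≠ 0`. [folklore] -/
theorem one_sub_X_sq_ne_zero : (1 - X ^ 2 : ℂ⟦X⟧) ≠ 0 := by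
  intro h
  have := congrArg (coeff 0) h
  simp at this

/-- **The local series of the square indicator**: `∑_k [IsSquare p^k] X^k = (1 − X)⁻¹(1 + X)⁻¹ =
geom 1 · geom (−1)`. [folklore] -/
theorem localSeries_sqInd {p : ℕ} (hp : p.Prime) :
    localSeries (toArithmeticFunction sqInd) p = geom 1 * geom (-1) := by
  rw [localSeries_sqInd_eq_mk hp]
  exact eq_of_mul_eq_mul_of_ne_zero one_sub_X_sq_ne_zero (by rw [evenSeries_mul, geom_one_mul_geom_neg_one_mul])

omit [NeZero N] in
/-- The local series `D_p(X) = ∑_e (|a_{p^e}|²/p^e) X^e` of `normSqCoeffDiv f`. [folklore] -/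
theorem localSeries_normSqCoeffDiv (f : CuspForm (Gamma0 N) 2) {p : ℕ} (hp : p.Prime) :
    localSeries (toArithmeticFunction (normSqCoeffDiv f)) p =
      PowerSeries.mk fun e ↦ (((‖cuspCoeff f (p ^ e)‖ ^ 2 / (p : ℝ) ^ e : ℝ)) : ℂ) := by
  ext e
  simp only [localSeries, coeff_mk, toArithmeticFunction, ArithmeticFunction.coe_mk,
    pow_ne_zero _ hp.ne_zero, if_false, normSqCoeffDiv, Nat.cast_pow]

/-- **The good local factor, formally**: for a newform `f` on `Γ₀(N)` and `p ∤ N`, with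
`d_e = |a_{p^e}|²/p^e` and `T = |a_p|²/p − 2`,
`(∑_e d_e X^e) · (1 − X)(1 − T X + X²) = 1 + X` in `ℂ⟦X⟧` (the order-three recursion for `a_{p^e}²`
from `a_{p^{e+2}} = a_p a_{p^{e+1}} − p a_{p^e}`; the formal version of
`IsNewform0.tsum_normSq_cuspCoeff_prime_pow_mul_eq`). [cite: Bump1997, §3.9 (PDF p. 382)] -/
theorem IsNewform0.localSeries_normSqCoeffDiv_mul (f : CuspForm (Gamma0 N) 2) (hf : IsNewform0 f) {p : ℕ}
    (hp : p.Prime) (hpN : ¬ p ∣ N) :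
    localSeries (toArithmeticFunction (normSqCoeffDiv f)) p *
        ((1 - X) * (1 - PowerSeries.C ((symmSqT f p : ℝ) : ℂ) * X + X ^ 2)) = 1 + X := by
  rw [localSeries_normSqCoeffDiv f hp]
  -- real coefficients `u e = a_{p^e}` and the recursion
  obtain ⟨u, hu⟩ : ∃ u : ℕ → ℝ, ∀ e, (cuspCoeff f (p ^ e)).re = u e := ⟨_, fun _ ↦ rfl⟩
  have hc : ∀ e, ‖cuspCoeff f (p ^ e)‖ ^ 2 = u e ^ 2 := fun e ↦ by rw [hf.norm_cuspCoeff_sq, hu]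
  have hu0 : u 0 = 1 := by rw [← hu, pow_zero, hf.re_cuspCoeff_one]
  have hp1 : (cuspCoeff f p).re = u 1 := by rw [← hu 1, pow_one]
  have hA2 : ‖cuspCoeff f p‖ ^ 2 = u 1 ^ 2 := by rw [← hc 1, pow_one]
  have hrec : ∀ e, u (e + 2) = u 1 * u (e + 1) - p * u e := fun e ↦ by
    have h := hf.re_cuspCoeff_prime_pow_add_two hp e
    simp only [if_neg hpN, hu, hp1] at h
    exact h
  have hp0 : (p : ℝ) ≠ 0 := by exact_mod_cast hp.ne_zero
  have hpos : (0 : ℝ) < p := by exact_mod_cast hp.pos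
  -- normalised coefficients `d e = u_e² / p^e` and `T = u_1²/p − 2`
  set d : ℕ → ℝ := fun e ↦ u e ^ 2 / (p : ℝ) ^ e with hd
  set T : ℝ := symmSqT f p with hTdef
  have hT : T = u 1 ^ 2 / p - 2 := by rw [hTdef, symmSqT, hA2]
  have hd0 : d 0 = 1 := by simp [hd, hu0]
  have hd1 : d 1 = T + 2 := by simp only [hd, pow_one, hT]; ring
  have hd2 : d 2 = (T + 1) ^ 2 := by
    have h2 : u 2 = u 1 ^ 2 - p := by
      have h := hrec 0
      rw [zero_add, zero_add, hu0, mul_one] at h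
      rw [h]; ring
    simp only [hd, h2, hT]
    field_simp
    ring
  have hdrec : ∀ e, d (e + 3) = (T + 1) * d (e + 2) - (T + 1) * d (e + 1) + d e := by
    intro e
    have h2 : u (e + 2) = u 1 * u (e + 1) - p * u e := hrec e
    have h3 : u (e + 3) = u 1 * u (e + 2) - p * u (e + 1) := hrec (e + 1)
    simp only [hd, hT]
    rw [h3, h2]
    field_simp
    ring
  -- compare coefficients
  have hmk : (PowerSeries.mk fun e ↦ (((‖cuspCoeff f (p ^ e)‖ ^ 2 / (p : ℝ) ^ e : ℝ)) : ℂ)) =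
      PowerSeries.mk fun e ↦ ((d e : ℝ) : ℂ) := by
    ext e; simp [hd, hc]
  rw [hmk]
  set D : ℂ⟦X⟧ := PowerSeries.mk fun e ↦ ((d e : ℝ) : ℂ) with hD
  have hcoef : ∀ n, coeff n D = ((d n : ℝ) : ℂ) := fun n ↦ by rw [hD, coeff_mk]
  -- expand the cubic
  have hcubic : ((1 - X) * (1 - PowerSeries.C ((T : ℝ) : ℂ) * X + X ^ 2) : ℂ⟦X⟧) =
      1 - PowerSeries.C (((T + 1 : ℝ)) : ℂ) * X ^ 1 + PowerSeries.C (((T + 1 : ℝ)) : ℂ) * X ^ 2 - X ^ 3 := by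
    rw [show (((T + 1 : ℝ)) : ℂ) = ((T : ℝ) : ℂ) + 1 by push_cast; ring, map_add, map_one, pow_one]
    ring
  rw [hcubic]
  ext n
  simp only [mul_sub, mul_add, mul_one, map_add, map_sub, coeff_one]
  rw [show D * (PowerSeries.C (((T + 1 : ℝ)) : ℂ) * X ^ 1) = PowerSeries.C (((T + 1 : ℝ)) : ℂ) * (D * X ^ 1) by ring,
    show D * (PowerSeries.C (((T + 1 : ℝ)) : ℂ) * X ^ 2) = PowerSeries.C (((T + 1 : ℝ)) : ℂ) * (D * X ^ 2) by ring,
    coeff_C_mul, coeff_C_mul, coeff_mul_X_pow', coeff_mul_X_pow', coeff_mul_X_pow', hcoef,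
    show coeff n (X : ℂ⟦X⟧) = if n = 1 then 1 else 0 from by rw [← pow_one (X : ℂ⟦X⟧), coeff_X_pow]]
  rcases n with _ | _ | _ | n
  · simp [hd0]
  · simp [hcoef, hd0, hd1]; ring
  · simp [hcoef, hd0, hd1, hd2]; ring
  · have h1 : (1 : ℕ) ≤ n + 1 + 1 + 1 := by omega
    have h2 : (2 : ℕ) ≤ n + 1 + 1 + 1 := by omega
    have h3 : (3 : ℕ) ≤ n + 1 + 1 + 1 := by omega
    simp only [if_pos h1, if_pos h2, if_pos h3, show n + 1 + 1 + 1 - 1 = n + 2 by omega,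
      show n + 1 + 1 + 1 - 2 = n + 1 by omega, show n + 1 + 1 + 1 - 3 = n by omega,
      show n + 1 + 1 + 1 ≠ 0 by omega, show n + 1 + 1 + 1 ≠ 1 by omega, if_false, hcoef, add_zero]
    rw [show n + 1 + 1 + 1 = n + 3 by ring, hdrec n]
    push_cast
    ring

end Local

/-! ### The local series of `rankinCoeff f` is `H_{A_f(p)}` -/

section LocalRankin

variable {N : ℕ} [NeZero N] {f : CuspForm (Gamma0 N) 2}

omit [NeZero N] in
/-- `toArithmeticFunction (rankinCoeff f) = toAF(sqInd) * toAF(|a|²/n)`. [folklore] -/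
theorem toArithmeticFunction_rankinCoeff (f : CuspForm (Gamma0 N) 2) :
    toArithmeticFunction (rankinCoeff f) =
      toArithmeticFunction sqInd * toArithmeticFunction (normSqCoeffDiv f) := by
  unfold rankinCoeff LSeries.convolution
  exact ArithmeticFunction.toArithmeticFunction_eq_self _

omit [NeZero N] in
/-- `H_{(1, S)} = geom 1 · geom S₀ · geom S₁ · geom S₂`. [folklore] -/
theorem hGen_symmSqA (f : CuspForm (Gamma0 N) 2) (p : ℕ) :
    hGen (symmSqA f p) = geom 1 * (geom (symmSqS f p 0) * geom (symmSqS f p 1) * geom (symmSqS f p 2)) := by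
  unfold hGen symmSqA
  rw [Fin.prod_univ_four]
  simp only [Fin.cons_zero, show (1 : Fin 4) = Fin.succ 0 from rfl, show (2 : Fin 4) = Fin.succ 1 from rfl,
    show (3 : Fin 4) = Fin.succ 2 from rfl, Fin.cons_succ]
  ring

/-- **Bad primes**: for a newform `f` and `p ∣ N`, `∑_e (|a_{p^e}|²/p^e) X^e = geom (|a_p|²/p)`
(`a_{p^e} = a_p^e`). [folklore] -/
theorem IsNewform0.localSeries_normSqCoeffDiv_of_dvd (hf : IsNewform0 f) {p : ℕ} (hp : p.Prime) (hpN : p ∣ N) :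
    localSeries (toArithmeticFunction (normSqCoeffDiv f)) p = geom (((‖cuspCoeff f p‖ ^ 2 / p : ℝ)) : ℂ) := by
  rw [localSeries_normSqCoeffDiv f hp]
  ext e
  rw [coeff_mk, coeff_geom, hf.cuspCoeff_prime_pow_of_dvd hp hpN e, norm_pow, ← pow_mul, mul_comm e 2, pow_mul,
    ← div_pow, Complex.ofReal_pow]

/-- **The local series of `rankinCoeff f` at a bad prime** is `H_{A_f(p)}`, `A_f(p) = (1, −1, |a_p|²/p, 0)`.
[folklore] -/
theorem IsNewform0.localSeries_rankinCoeff_of_dvd (hf : IsNewform0 f) {p : ℕ} (hp : p.Prime) (hpN : p ∣ N) :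
    localSeries (toArithmeticFunction (rankinCoeff f)) p = hGen (symmSqA f p) := by
  rw [toArithmeticFunction_rankinCoeff, localSeries_mul _ _ hp, localSeries_sqInd hp,
    hf.localSeries_normSqCoeffDiv_of_dvd hp hpN, hGen_symmSqA]
  unfold symmSqS
  simp only [if_pos hpN, Matrix.cons_val_zero, Matrix.cons_val_one, Matrix.cons_val]
  rw [geom_zero_eq_one]
  ring

/-- **The local series of `rankinCoeff f` at a good prime** is `H_{A_f(p)}`, `A_f(p) = (1, 1, u_p, ū_p)`
with `u_p + ū_p = |a_p|²/p − 2`, `u_p ū_p = 1` (needs `|a_p|² ≤ 4p`, i.e. `|T_p| ≤ 2`):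
`(1 − X)⁻¹(1 + X)⁻¹ · (1 + X)/((1 − X)(1 − T X + X²)) = ((1 − X)²(1 − uX)(1 − ūX))⁻¹`.
[cite: Bump1997, §3.9 (PDF p. 382)] -/
theorem IsNewform0.localSeries_rankinCoeff_of_not_dvd (hf : IsNewform0 f) {p : ℕ} (hp : p.Prime)
    (hpN : ¬ p ∣ N) (hT : |symmSqT f p| ≤ 2) :
    localSeries (toArithmeticFunction (rankinCoeff f)) p = hGen (symmSqA f p) := by
  set u : ℂ := symmSqRoot f p with hu
  have hS0 : symmSqS f p 0 = 1 := by unfold symmSqS; rw [if_neg hpN]; rfl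
  have hS1 : symmSqS f p 1 = u := by unfold symmSqS; rw [if_neg hpN]; rfl
  have hS2 : symmSqS f p 2 = conj u := by unfold symmSqS; rw [if_neg hpN]; rfl
  rw [toArithmeticFunction_rankinCoeff, localSeries_mul _ _ hp, localSeries_sqInd hp, hGen_symmSqA, hS0, hS1, hS2]
  -- cancel the common denominator `Q = (1 − X)(1 − X)(1 − uX)(1 − ūX)`
  set D := localSeries (toArithmeticFunction (normSqCoeffDiv f)) p with hD
  have hquad : ((1 - PowerSeries.C u * X) * (1 - PowerSeries.C (conj u) * X) : ℂ⟦X⟧) =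
      1 - PowerSeries.C ((symmSqT f p : ℝ) : ℂ) * X + X ^ 2 := by
    have h1 : PowerSeries.C u * PowerSeries.C (conj u) = (1 : ℂ⟦X⟧) := by
      rw [← map_mul, symmSqRoot_mul_conj, map_one]
    have h2 : PowerSeries.C u + PowerSeries.C (conj u) = (PowerSeries.C ((symmSqT f p : ℝ) : ℂ) : ℂ⟦X⟧) := by
      rw [← map_add, symmSqRoot_add_conj f p hT]
    calc ((1 - PowerSeries.C u * X) * (1 - PowerSeries.C (conj u) * X) : ℂ⟦X⟧)
        = 1 - (PowerSeries.C u + PowerSeries.C (conj u)) * X + (PowerSeries.C u * PowerSeries.C (conj u)) * X ^ 2 := by ring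
      _ = _ := by rw [h1, h2]; ring
  have hQ : ((1 - PowerSeries.C (1 : ℂ) * X) * (1 - PowerSeries.C (1 : ℂ) * X) *
      ((1 - PowerSeries.C u * X) * (1 - PowerSeries.C (conj u) * X)) : ℂ⟦X⟧) ≠ 0 :=
    mul_ne_zero (mul_ne_zero (one_sub_C_mul_X_ne_zero 1) (one_sub_C_mul_X_ne_zero 1))
      (mul_ne_zero (one_sub_C_mul_X_ne_zero u) (one_sub_C_mul_X_ne_zero _))
  refine eq_of_mul_eq_mul_of_ne_zero hQ ?_
  have hrec := hf.localSeries_normSqCoeffDiv_mul f hp hpN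
  rw [← hD] at hrec
  have hC1 : (1 - PowerSeries.C (1 : ℂ) * X : ℂ⟦X⟧) = 1 - X := by rw [map_one, one_mul]
  -- left side
  have hL : geom (1 : ℂ) * geom (-1) * D *
      ((1 - PowerSeries.C (1 : ℂ) * X) * (1 - PowerSeries.C (1 : ℂ) * X) *
        ((1 - PowerSeries.C u * X) * (1 - PowerSeries.C (conj u) * X))) = 1 := by
    calc geom (1 : ℂ) * geom (-1) * D *
        ((1 - PowerSeries.C (1 : ℂ) * X) * (1 - PowerSeries.C (1 : ℂ) * X) *
          ((1 - PowerSeries.C u * X) * (1 - PowerSeries.C (conj u) * X)))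
        = (geom (1 : ℂ) * (1 - PowerSeries.C (1 : ℂ) * X)) * geom (-1) *
            (D * ((1 - PowerSeries.C (1 : ℂ) * X) * ((1 - PowerSeries.C u * X) * (1 - PowerSeries.C (conj u) * X)))) := by
          ring
      _ = geom (-1) * (1 + X) := by rw [geom_mul_one_sub, one_mul, hquad, hC1, hrec]
      _ = geom (-1) * (1 - PowerSeries.C (-1 : ℂ) * X) := by rw [map_neg, map_one]; ring
      _ = 1 := geom_mul_one_sub _
  -- right side
  have hR : geom (1 : ℂ) * (geom 1 * geom u * geom (conj u)) *
      ((1 - PowerSeries.C (1 : ℂ) * X) * (1 - PowerSeries.C (1 : ℂ) * X) *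
        ((1 - PowerSeries.C u * X) * (1 - PowerSeries.C (conj u) * X))) = 1 := by
    calc geom (1 : ℂ) * (geom 1 * geom u * geom (conj u)) *
        ((1 - PowerSeries.C (1 : ℂ) * X) * (1 - PowerSeries.C (1 : ℂ) * X) *
          ((1 - PowerSeries.C u * X) * (1 - PowerSeries.C (conj u) * X)))
        = (geom (1 : ℂ) * (1 - PowerSeries.C (1 : ℂ) * X)) * (geom (1 : ℂ) * (1 - PowerSeries.C (1 : ℂ) * X)) *
            (geom u * (1 - PowerSeries.C u * X)) * (geom (conj u) * (1 - PowerSeries.C (conj u) * X)) := by ring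
      _ = 1 := by simp only [geom_mul_one_sub, mul_one]
  rw [hL, hR]

end LocalRankin

/-! ### Multiplicativity and the global identity `rankinCoeff f = eulerFun A_f` -/

section Global

variable {N : ℕ} [NeZero N] {f : CuspForm (Gamma0 N) 2}

/-- `toAF(sqInd)` is multiplicative. [folklore] -/
theorem isMultiplicative_toArithmeticFunction_sqInd : (toArithmeticFunction sqInd).IsMultiplicative := by
  refine ⟨by simp [toArithmeticFunction, sqInd], fun {m n} hmn ↦ ?_⟩
  rcases eq_or_ne m 0 with rfl | hm
  · simp [toArithmeticFunction]
  rcases eq_or_ne n 0 with rfl | hn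
  · simp [toArithmeticFunction]
  simp only [toArithmeticFunction, ArithmeticFunction.coe_mk, mul_ne_zero hm hn, hm, hn, if_false, sqInd,
    RankinEisenstein.isSquare_mul_iff_of_coprime hmn]
  by_cases h1 : IsSquare m <;> by_cases h2 : IsSquare n <;> simp [h1, h2]

/-- `toAF(|a|²/n)` is multiplicative for a newform. [folklore] -/
theorem IsNewform0.isMultiplicative_toArithmeticFunction_normSqCoeffDiv (hf : IsNewform0 f) :
    (toArithmeticFunction (normSqCoeffDiv f)).IsMultiplicative := by
  refine ⟨?_, fun {m n} hmn ↦ ?_⟩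
  · show (if (1 : ℕ) = 0 then (0 : ℂ) else normSqCoeffDiv f 1) = 1
    rw [if_neg one_ne_zero, normSqCoeffDiv, show cuspCoeff f 1 = 1 from hf.2.2]
    simp
  rcases eq_or_ne m 0 with rfl | hm
  · simp [toArithmeticFunction]
  rcases eq_or_ne n 0 with rfl | hn
  · simp [toArithmeticFunction]
  simp only [toArithmeticFunction, ArithmeticFunction.coe_mk, mul_ne_zero hm hn, hm, hn, if_false, normSqCoeffDiv]
  have hmul : cuspCoeff f (m * n) = cuspCoeff f m * cuspCoeff f n := IsNewform0.coeff_mul_of_coprime_holds hf hmn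
  rw [hmul, norm_mul, mul_pow, Nat.cast_mul]
  push_cast
  have hm' : (m : ℂ) ≠ 0 := by exact_mod_cast hm
  have hn' : (n : ℂ) ≠ 0 := by exact_mod_cast hn
  field_simp

/-- `toAF(rankinCoeff f)` is multiplicative. [folklore] -/
theorem IsNewform0.isMultiplicative_toArithmeticFunction_rankinCoeff (hf : IsNewform0 f) :
    (toArithmeticFunction (rankinCoeff f)).IsMultiplicative := by
  rw [toArithmeticFunction_rankinCoeff]
  exact isMultiplicative_toArithmeticFunction_sqInd.mul hf.isMultiplicative_toArithmeticFunction_normSqCoeffDiv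

variable (f) in
/-- The four parameter FUNCTIONS `p ↦ A_f(p)_l`. [folklore] -/
def symmSqAFun : Fin 4 → ℕ → ℂ := fun l p ↦ symmSqA f p l

variable (f) in
/-- The three parameter FUNCTIONS `p ↦ S_f(p)_l`. [folklore] -/
def symmSqSFun : Fin 3 → ℕ → ℂ := fun l p ↦ symmSqS f p l

/-- **Hasse ⇒ `|T_p| ≤ 2`** for the newform of an elliptic curve at a good prime (`|a_p|² ≤ 4p`).
[cite: SilvermanAEC2009, Thm. V.1.1] -/
theorem IsNewformOf.abs_symmSqT_le {W : WeierstrassCurve ℚ} [W.IsElliptic] (hf : IsNewformOf W f)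
    {p : ℕ} (hp : p.Prime) : |symmSqT f p| ≤ 2 := by
  have h := hf.norm_cuspCoeff_prime_pow_sq_le hp 1
  rw [pow_one, pow_one] at h
  have hp0 : (0 : ℝ) < p := by exact_mod_cast hp.pos
  have hq : ‖cuspCoeff f p‖ ^ 2 / p ≤ 4 := by
    rw [div_le_iff₀ hp0]; norm_num at h; linarith
  have hq0 : 0 ≤ ‖cuspCoeff f p‖ ^ 2 / p := by positivity
  rw [symmSqT, abs_le]
  constructor <;> linarith

/-- **`rankinCoeff f = eulerFun A_f`** (as arithmetic functions): the coefficients of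
`ζ(s)·L_f(s) = ζ(2s) Σ|a_n|² n^{−1−s}` are those of the Euler product
`∏_p ∏_{l<4} (1 − A_f(p)_l p^{−s})⁻¹` — both sides are multiplicative and agree on prime powers.
[cite: Bump1997, §3.9 (PDF p. 382)] -/
theorem IsNewformOf.toArithmeticFunction_rankinCoeff_eq {W : WeierstrassCurve ℚ} [W.IsElliptic]
    (hf : IsNewformOf W f) : toArithmeticFunction (rankinCoeff f) = eulerFun (symmSqAFun f) := by
  refine (ArithmeticFunction.IsMultiplicative.eq_iff_eq_on_prime_powers _
    hf.1.isMultiplicative_toArithmeticFunction_rankinCoeff _ (isMultiplicative_eulerFun _)).mpr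
    fun p k hp ↦ ?_
  have hloc : localSeries (toArithmeticFunction (rankinCoeff f)) p = hGen (symmSqA f p) := by
    by_cases hpN : p ∣ N
    · exact hf.1.localSeries_rankinCoeff_of_dvd hp hpN
    · exact hf.1.localSeries_rankinCoeff_of_not_dvd hp hpN (hf.abs_symmSqT_le hp)
  have h := congrArg (coeff k) hloc
  rw [localSeries, coeff_mk] at h
  rw [h, eulerFun_prime_pow _ hp]
  rfl

/-- **`rankinCoeff f = eulerFun A_f` as functions.** [cite: Bump1997, §3.9 (PDF p. 382)] -/
theorem IsNewformOf.rankinCoeff_eq {W : WeierstrassCurve ℚ} [W.IsElliptic] (hf : IsNewformOf W f) :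
    rankinCoeff f = ⇑(eulerFun (symmSqAFun f)) := by
  funext n
  rcases eq_or_ne n 0 with rfl | hn
  · rw [rankinCoeff, LSeries.convolution_map_zero, ArithmeticFunction.map_zero]
  · have h := congrArg (fun F : ArithmeticFunction ℂ ↦ F n) hf.toArithmeticFunction_rankinCoeff_eq
    simpa [toArithmeticFunction, hn] using h

end Global

/-! ### The pair: `Z_{ij} = eulerFun (A_i ⊗ A_j)` and `P_{ij} = L(s, eulerFun (S_i ⊗ S_j))` -/

section Pair

/-- The sixteen parameter functions `A_i ⊗ A_j` of the auxiliary series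
`Z_{ij}(s) = ζ(s) L_i(s) L_j(s) P_{ij}(s)`. [cite: Goldfeld2006, Lemma 8.7.5 (proof)] -/
def pairZFun (i j : EllipticNewformIndex) : Fin (4 * 4) → ℕ → ℂ :=
  fun l p ↦ tensorFin (symmSqA i.f p) (symmSqA j.f p) l

/-- **The coefficients `a_{ij}` of the auxiliary series** `Z_{ij} = ζ · L_i · L_j · P_{ij}`.
[cite: Goldfeld2006, Lemma 8.7.5 (proof)] -/
def pairZ (i j : EllipticNewformIndex) : ArithmeticFunction ℂ := eulerFun (pairZFun i j)

/-- The nine parameter functions `S_i ⊗ S_j` of the pair function `P_{ij}` (at good primes the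
Satake parameters of `Sym² f_i × Sym² f_j`). [folklore] -/
def pairPFun (i j : EllipticNewformIndex) : Fin (3 * 3) → ℕ → ℂ :=
  fun l p ↦ tensorFin (symmSqS i.f p) (symmSqS j.f p) l

/-- **The explicit pair function** `P_{ij}(s) = ∑_n eulerFun(S_i ⊗ S_j)(n) n^{−s}` (`Re s > 1`): the
Euler product `∏_p ∏_{a,b<3} (1 − S_i(p)_a S_j(p)_b p^{−s})⁻¹`, i.e. at the primes `p ∤ N_iN_j` the local
factor `L_p(s, Sym² f_i × Sym² f_j)` of the Rankin–Selberg convolution of the two symmetric squares,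
and explicit correcting factors at `p ∣ N_iN_j`. Beyond `Re s > 1` the value is Mathlib's junk value
of a divergent `LSeries`; the CONTINUATION of `P_{ij}` is the remaining (GL₃ × GL₃) input.
[cite: HoffsteinLockhart1994, §1 (L(s, F × G))] -/
def pairP (i j : EllipticNewformIndex) (s : ℂ) : ℂ := LSeries (⇑(eulerFun (pairPFun i j))) s

/-- Bounds on the parameters. [folklore] -/
theorem norm_pairZFun_le (i j : EllipticNewformIndex) (l : Fin (4 * 4)) (p : ℕ) (hp : p.Prime) :
    ‖pairZFun i j l p‖ ≤ 1 :=
  norm_tensorFin_le (fun a ↦ i.isNewformOf.1.norm_symmSqA_le hp a) (fun b ↦ j.isNewformOf.1.norm_symmSqA_le hp b) l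

/-- Bounds on the parameters. [folklore] -/
theorem norm_pairPFun_le (i j : EllipticNewformIndex) (l : Fin (3 * 3)) (p : ℕ) (hp : p.Prime) :
    ‖pairPFun i j l p‖ ≤ 1 :=
  norm_tensorFin_le (fun a ↦ i.isNewformOf.1.norm_symmSqS_le hp a) (fun b ↦ j.isNewformOf.1.norm_symmSqS_le hp b) l

/-- **`a_{ij}(n) ≥ 0`** (Goldfeld–Hoffstein–Lieman: the power sums of `A_i ⊗ A_j` are the products
`p_k(A_i) p_k(A_j) ≥ 0`). [cite: Goldfeld2006, Lemma 8.7.5] -/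
theorem pairZ_nonneg (i j : EllipticNewformIndex) : 0 ≤ (⇑(pairZ i j) : ℕ → ℂ) := by
  refine eulerFun_nonneg' _ fun p _ k hk ↦ ?_
  have h : psum (fun l ↦ pairZFun i j l p) k = psum (symmSqA i.f p) k * psum (symmSqA j.f p) k :=
    psum_tensorFin _ _ k
  rw [h]
  exact mul_nonneg (psum_symmSqA_nonneg i.f p hk) (psum_symmSqA_nonneg j.f p hk)

/-- `a_{ij}(1) = 1`. [folklore] -/
theorem pairZ_one (i j : EllipticNewformIndex) : pairZ i j 1 = 1 := eulerFun_one _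

/-- `∑ a_{ij}(n) n^{−s}` converges absolutely for `Re s > 1`. [folklore] -/
theorem LSeriesSummable_pairZ (i j : EllipticNewformIndex) {s : ℂ} (hs : 1 < s.re) :
    LSeriesSummable (⇑(pairZ i j)) s :=
  LSeriesSummable_eulerFun (fun l p hp ↦ norm_pairZFun_le i j l p hp) hs

/-! ### The identity `ζ · L_i · L_j · P_{ij} = ∑ a_{ij}(n) n^{−s}` -/

/-- The parameter function of `ζ`: one parameter, identically `1`. [folklore] -/
def zetaFun : Fin 1 → ℕ → ℂ := fun _ _ ↦ 1

/-- `L(s, eulerFun zetaFun) = ζ(s)` for `Re s > 1` (both are `∏_p (1 − p^{−s})⁻¹`). [folklore] -/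
theorem LSeries_eulerFun_zetaFun {s : ℂ} (hs : 1 < s.re) : LSeries (⇑(eulerFun zetaFun)) s = riemannZeta s := by
  have h1 := hasProd_eulerFun (c := zetaFun) (fun _ _ _ ↦ by simp [zetaFun]) hs
  have h2 := riemannZeta_eulerProduct_hasProd hs
  have e : (fun p : Nat.Primes ↦ ∏ l : Fin 1, (1 - zetaFun l p * (p : ℂ) ^ (-s))⁻¹) =
      fun p : Nat.Primes ↦ (1 - (p : ℂ) ^ (-s))⁻¹ := by
    funext p; simp [zetaFun]
  rw [e] at h1
  exact h1.unique h2

/-- `H_{v ⊗ w} = ∏_a ∏_b geom (v_a w_b)`. [folklore] -/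
theorem hGen_tensorFin {a b : ℕ} (v : Fin a → ℂ) (w : Fin b → ℂ) :
    hGen (tensorFin v w) = ∏ x, ∏ y, geom (v x * w y) := by
  unfold hGen tensorFin
  rw [← Fintype.prod_equiv finProdFinEquiv (fun xy : Fin a × Fin b ↦ geom (v xy.1 * w xy.2)) _ (fun xy ↦ by simp),
    Fintype.prod_prod_type]

/-- `H_{(c, v)} = geom c · H_v`. [folklore] -/
theorem hGen_cons {n : ℕ} (c : ℂ) (v : Fin n → ℂ) : hGen (Fin.cons c v : Fin (n + 1) → ℂ) = geom c * hGen v := by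
  unfold hGen
  rw [Fin.prod_univ_succ, Fin.cons_zero]
  simp only [Fin.cons_succ]

/-- **The local factorisation** `H_{A_i} · H_{A_j} · H_{S_i ⊗ S_j} = geom 1 · H_{A_i ⊗ A_j}` for
`A = (1, S)`: the sixteen products `A_i ⊗ A_j` are `1`, `S_j`, `S_i` and `S_i ⊗ S_j`. [folklore] -/
theorem hGen_pair_local {Si Sj : Fin 3 → ℂ} :
    hGen (Fin.cons 1 Si : Fin 4 → ℂ) * hGen (Fin.cons 1 Sj : Fin 4 → ℂ) * hGen (tensorFin Si Sj) =
      geom 1 * hGen (tensorFin (Fin.cons 1 Si : Fin 4 → ℂ) (Fin.cons 1 Sj : Fin 4 → ℂ)) := by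
  rw [hGen_tensorFin, hGen_tensorFin, hGen_cons, hGen_cons]
  unfold hGen
  simp only [Fin.prod_univ_succ, Fin.prod_univ_zero, Fin.cons_zero, Fin.cons_succ, mul_one, one_mul]
  ring

/-- **The identity of arithmetic functions** `eulerFun A_i * eulerFun A_j * eulerFun (S_i ⊗ S_j) =
eulerFun 1 * Z_{ij}` (all multiplicative; equal local series at every prime). [folklore] -/
theorem eulerFun_pair_identity (i j : EllipticNewformIndex) :
    eulerFun (symmSqAFun i.f) * eulerFun (symmSqAFun j.f) * eulerFun (pairPFun i j) =
      eulerFun zetaFun * pairZ i j := by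
  have hm1 := ((isMultiplicative_eulerFun (symmSqAFun i.f)).mul (isMultiplicative_eulerFun (symmSqAFun j.f))).mul
    (isMultiplicative_eulerFun (pairPFun i j))
  have hm2 : (eulerFun zetaFun * pairZ i j).IsMultiplicative :=
    (isMultiplicative_eulerFun zetaFun).mul (isMultiplicative_eulerFun (pairZFun i j))
  refine (ArithmeticFunction.IsMultiplicative.eq_iff_eq_on_prime_powers _ hm1 _ hm2).mpr fun p k hp ↦ ?_
  have hloc : localSeries (eulerFun (symmSqAFun i.f) * eulerFun (symmSqAFun j.f) * eulerFun (pairPFun i j)) p =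
      localSeries (eulerFun zetaFun * pairZ i j) p := by
    rw [localSeries_mul _ _ hp, localSeries_mul _ _ hp, localSeries_mul _ _ hp, pairZ, localSeries_eulerFun _ hp,
      localSeries_eulerFun _ hp, localSeries_eulerFun _ hp, localSeries_eulerFun _ hp, localSeries_eulerFun _ hp]
    have hz : hGen (fun l : Fin 1 ↦ zetaFun l p) = geom 1 := by
      unfold hGen zetaFun; rw [Fin.prod_univ_one]
    rw [hz]
    exact hGen_pair_local
  have h := congrArg (coeff k) hloc
  simpa [localSeries] using h

/-- **`L(s, rankinCoeff_i) · L(s, rankinCoeff_j) · P_{ij}(s) = ζ(s) · ∑ a_{ij}(n) n^{−s}`** for `Re s > 1`.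
[folklore] -/
theorem LSeries_rankinCoeff_mul_pairP (i j : EllipticNewformIndex) {s : ℂ} (hs : 1 < s.re) :
    LSeries (rankinCoeff i.f) s * LSeries (rankinCoeff j.f) s * pairP i j s =
      riemannZeta s * LSeries (⇑(pairZ i j)) s := by
  have hAi : ∀ l (p : ℕ), p.Prime → ‖symmSqAFun i.f l p‖ ≤ 1 := fun l p hp ↦ i.isNewformOf.1.norm_symmSqA_le hp l
  have hAj : ∀ l (p : ℕ), p.Prime → ‖symmSqAFun j.f l p‖ ≤ 1 := fun l p hp ↦ j.isNewformOf.1.norm_symmSqA_le hp l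
  have hP : ∀ l (p : ℕ), p.Prime → ‖pairPFun i j l p‖ ≤ 1 := fun l p hp ↦ norm_pairPFun_le i j l p hp
  have hZ : ∀ l (p : ℕ), p.Prime → ‖pairZFun i j l p‖ ≤ 1 := fun l p hp ↦ norm_pairZFun_le i j l p hp
  have hz : ∀ l (p : ℕ), p.Prime → ‖zetaFun l p‖ ≤ 1 := fun _ _ _ ↦ by simp [zetaFun]
  have sAi := LSeriesSummable_eulerFun hAi hs
  have sAj := LSeriesSummable_eulerFun hAj hs
  have sP := LSeriesSummable_eulerFun hP hs
  have sZ := LSeriesSummable_eulerFun hZ hs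
  have sz := LSeriesSummable_eulerFun hz hs
  have h : LSeries (⇑(eulerFun (symmSqAFun i.f) * eulerFun (symmSqAFun j.f) * eulerFun (pairPFun i j))) s =
      LSeries (⇑(eulerFun zetaFun * pairZ i j)) s :=
    congrArg (fun F : ArithmeticFunction ℂ ↦ LSeries (⇑F) s) (eulerFun_pair_identity i j)
  rw [ArithmeticFunction.LSeries_mul' (ArithmeticFunction.LSeriesSummable_mul sAi sAj) sP,
    ArithmeticFunction.LSeries_mul' sAi sAj, pairZ, ArithmeticFunction.LSeries_mul' sz sZ,
    LSeries_eulerFun_zetaFun hs] at h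
  rw [i.isNewformOf.rankinCoeff_eq, j.isNewformOf.rankinCoeff_eq, pairP, pairZ]
  exact h

/-- **Hoffstein–Lockhart's `hcoeff₃` for the explicit pair function, PROVED**: for every pair of
elliptic newforms and `Re s > 1`,
`riemannZeta₁(s) · (L_i(s) L_j(s) P_{ij}(s)) = (s − 1) · ∑_n a_{ij}(n) n^{−s}` with `a_{ij} ≥ 0`,
`a_{ij}(1) = 1` and `∑ |a_{ij}(n)| n^{−σ} < ∞` (`L = symmSqL`, the imprimitive symmetric square;
`riemannZeta₁ · L_i = (s − 1) L(s, rankinCoeff_i)`). No hypothesis on CM or twist-equivalence is needed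
for this item. [cite: HoffsteinLockhart1994, §1 (proof of Thm. 0.1)] [cite: Goldfeld2006, Lemma 8.7.5] -/
theorem pair_coeff₃ (i j : EllipticNewformIndex) :
    ∃ a : ℕ → ℂ, 0 ≤ a ∧ a 1 = 1 ∧ (∀ s : ℂ, 1 < s.re → LSeriesSummable a s) ∧
      ∀ s : ℂ, 1 < s.re →
        riemannZeta₁ s * (symmSqL i.N i.f s * symmSqL j.N j.f s * pairP i j s) = (s - 1) * LSeries a s := by
  refine ⟨⇑(pairZ i j), pairZ_nonneg i j, pairZ_one i j, fun s hs ↦ LSeriesSummable_pairZ i j hs, fun s hs ↦ ?_⟩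
  have hs1 : s ≠ 1 := fun h ↦ by rw [h, Complex.one_re] at hs; exact lt_irrefl _ hs
  have hζ₁ : riemannZeta₁ s ≠ 0 := riemannZeta₁_ne_zero_of_one_le_re' hs.le
  have hi := riemannZeta₁_mul_symmSqL_eq_LSeries i.f hs
  have hj := riemannZeta₁_mul_symmSqL_eq_LSeries j.f hs
  have hP := LSeries_rankinCoeff_mul_pairP i j hs
  have hz := riemannZeta₁_eq_mul hs1
  refine mul_left_cancel₀ hζ₁ ?_
  linear_combination (riemannZeta₁ s * symmSqL j.N j.f s * pairP i j s) * hi +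
    ((s - 1) * LSeries (rankinCoeff i.f) s * pairP i j s) * hj + (s - 1) ^ 2 * hP -
    ((s - 1) * LSeries (⇑(pairZ i j)) s) * hz

end Pair

/-! ### The named fact from a continuation of the explicit pair functions -/

section Reduction

open _root_.WeierstrassCurve Metric

/-- **Murty's bound `(f, f) ≫_ε N^{1−ε}` ⇐ analytic continuation of the explicit Rankin–Selberg
Euler products `P_{ij}`**: suppose that for every pair of non-CM, non-twist-equivalent elliptic newforms
the explicit function `P_{ij}(s) = ∏_p ∏_{a,b} (1 − S_i(p)_a S_j(p)_b p^{−s})⁻¹` (`pairP`, `Re s > 1`)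
agrees on `Re s > 1` with a function `G_{ij}` holomorphic on the disc `|s − 2| < 3/2`, bounded there
by `B₂ (N_iN_j)^{κ₂}` on the closed disc and with `|G_{ij}(1)| ≤ T(η) (N_iN_j)^η` for every `η > 0`. Then
`murty_petersson_newform_lower_bound` holds. Of Hoffstein–Lockhart's four pair-data items, the
coefficient positivity is now PROVED (`pair_coeff₃`) and the CM side is PROVED
(`murty_petersson_newform_lower_bound_of_pairData_nonCM'`); what remains is exactly the holomorphy and
the polynomial bounds of `L(s, Sym² f_i × Sym² f_j)` (Gelbart–Jacquet + Mœglin–Waldspurger /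
Jacquet–Piatetski-Shapiro–Shalika, with conductor control). [cite: HoffsteinLockhart1994, Thm. 0.1, Lemma 1.2]
[cite: MurtyCongruencePrimes1999, §2 (3)] -/
theorem murty_petersson_newform_lower_bound_of_pairContinuation
    (G : EllipticNewformIndex → EllipticNewformIndex → ℂ → ℂ)
    (hGd : ∀ i j, ¬ i.W.HasCM → ¬ j.W.HasCM → ¬ TwistEquiv i j →
      DifferentiableOn ℂ (G i j) (ball (2 : ℂ) (3 / 2)))
    (hGeq : ∀ i j, ¬ i.W.HasCM → ¬ j.W.HasCM → ¬ TwistEquiv i j →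
      ∀ s : ℂ, 1 < s.re → G i j s = pairP i j s)
    {B₂ κ₂ : ℝ} (hB₂ : 0 ≤ B₂) (hκ₂ : 0 ≤ κ₂)
    (hGle : ∀ i j, ¬ i.W.HasCM → ¬ j.W.HasCM → ¬ TwistEquiv i j → ∀ s ∈ closedBall (2 : ℂ) (3 / 2),
      ‖G i j s‖ ≤ B₂ * ((i.N : ℝ) * j.N) ^ κ₂)
    (hG1 : ∀ η : ℝ, 0 < η → ∃ T : ℝ, ∀ i j, ¬ i.W.HasCM → ¬ j.W.HasCM → ¬ TwistEquiv i j →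
      ‖G i j 1‖ ≤ T * ((i.N : ℝ) * j.N) ^ η) :
    murty_petersson_newform_lower_bound := by
  refine murty_petersson_newform_lower_bound_of_pairData_nonCM' G hGd hB₂ hκ₂ hGle (fun i j hi hj hij ↦ ?_) hG1
  obtain ⟨a, ha0, ha1, hsum, hid⟩ := pair_coeff₃ i j
  exact ⟨a, ha0, ha1, hsum, fun s hs ↦ by rw [hGeq i j hi hj hij s hs]; exact hid s hs⟩

/-- The same with the CM predicate "`j ∈ cmJInvariants`" (no input from the class number one
theorem). [cite: HoffsteinLockhart1994, Thm. 0.1, Lemma 1.2] [cite: MurtyCongruencePrimes1999, §2 (3)] -/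
theorem murty_petersson_newform_lower_bound_of_pairContinuation_cmJ
    (G : EllipticNewformIndex → EllipticNewformIndex → ℂ → ℂ)
    (hGd : ∀ i j, i.W.j ∉ cmJInvariants → j.W.j ∉ cmJInvariants → ¬ TwistEquiv i j →
      DifferentiableOn ℂ (G i j) (ball (2 : ℂ) (3 / 2)))
    (hGeq : ∀ i j, i.W.j ∉ cmJInvariants → j.W.j ∉ cmJInvariants → ¬ TwistEquiv i j →
      ∀ s : ℂ, 1 < s.re → G i j s = pairP i j s)
    {B₂ κ₂ : ℝ} (hB₂ : 0 ≤ B₂) (hκ₂ : 0 ≤ κ₂)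
    (hGle : ∀ i j, i.W.j ∉ cmJInvariants → j.W.j ∉ cmJInvariants → ¬ TwistEquiv i j →
      ∀ s ∈ closedBall (2 : ℂ) (3 / 2), ‖G i j s‖ ≤ B₂ * ((i.N : ℝ) * j.N) ^ κ₂)
    (hG1 : ∀ η : ℝ, 0 < η → ∃ T : ℝ, ∀ i j, i.W.j ∉ cmJInvariants → j.W.j ∉ cmJInvariants →
      ¬ TwistEquiv i j → ‖G i j 1‖ ≤ T * ((i.N : ℝ) * j.N) ^ η) :
    murty_petersson_newform_lower_bound := by
  refine murty_petersson_newform_lower_bound_of_pairData_cmJ' G hGd hB₂ hκ₂ hGle (fun i j hi hj hij ↦ ?_) hG1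
  obtain ⟨a, ha0, ha1, hsum, hid⟩ := pair_coeff₃ i j
  exact ⟨a, ha0, ha1, hsum, fun s hs ↦ by rw [hGeq i j hi hj hij s hs]; exact hid s hs⟩

end Reduction



end Literature.NumberTheory.EllipticCurves.ModularForms

end
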